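import Summits.AtomisticToContinuum.HydrodynamicLimit.Theorems.RelayRaceLocalityNearConstantShortTimeHLTiltL2Assembly
import Summits.AtomisticToContinuum.HydrodynamicLimit.Theorems.RelayRaceLocalityNearConstantShortTimeHLReductionI
import Summits.AtomisticToContinuum.HydrodynamicLimit.Theorems.RelayRaceLocalityNearConstantShortTimeHLDynamicI
import HarnessLib

/-!
# Crux `NearConstantShortTimeHL` (stmt-AtomisticToContinuum-12502), line `small-tilt-domination`, skeleton v18 (lead c8):
# the ENDGAME under the INTEGRATED fourth-moment cap — the crux from THREE dynamical conjectures

Support file (`--supports stmt-AtomisticToContinuum-12502`). Composition of the landed pieces of skeleton v18: level 0 `stub_reductionI`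
(`…ReductionI`) ∘ level 1 `stub_dynamicI` (`…DynamicI`) through the means-pin dock and the entropy-to-LLN step, with the statics side of the
line closed (`…TiltL2Assembly`: `mesoscaleDensityLD_holds`, hence `MesoscaleSuperlinearityE`). Compared with v17
(`nearConstantShortTimeHL_of_dynamics4 : MomentumClosureTightness4 → EnergyClosureTightness4 → TrueLawCapsG → FourthMomentCapPreShock → crux`)
the a-priori input S4d `FourthMomentCapPreShock` — a sharp one-sided law of large numbers for the non-conserved quartic velocity moment,
uniformly in time, along the true non-equilibrium law — is GONE: the equilibrium closure K-stubs carry the integrated fourth-moment cap with a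
rate uniform in the cap level (`MomentumClosureTightnessI`, `EnergyClosureTightnessI`, `…IntCapDefs`; they imply the v14 K-stubs,
`momentumClosureTightness4_of_I`), and the cap failure along the true law is a theorem (`intFourthMoment_markov`: Tonelli along the jointly
measurable flow + Markov from the Gaussian velocity tails in mean that `TrueLawCapsG` provides). What stays open: the two equilibrium
dynamical large-deviation statements S2‴/S3‴ and the a-priori caps S4′ `TrueLawCapsG` (speed cap, ball-packing cap, Gaussian tails in mean
along the true law) — the hydrodynamic-limit inputs proper.
References: H.-T. Yau, Lett. Math. Phys. 22 (1991) §2.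
-/

noncomputable section

namespace Summit.AtomisticToContinuum.HydrodynamicLimit.Theorems.NearConstantShortTimeHL

open Summit.AtomisticToContinuum.HydrodynamicLimit.Theses.RelayRaceLocality (NearConstantShortTimeHL)

/-- **THE CRUX FROM ITS FOUR INPUTS UNDER THE INTEGRATED FOURTH-MOMENT CAP** (endgame of skeleton v18): the mesoscale static superlinearity
St2′, the equilibrium momentum / energy closure tightness at a rate uniform in the integrated cap level (S2‴, S3‴), and the a-priori caps
with Gaussian velocity tails along the true law (S4′). [cite: Yau1991, §2] -/
theorem nearConstantShortTimeHL_of_inputsI : MesoscaleSuperlinearityE → MomentumClosureTightnessI → EnergyClosureTightnessI → TrueLawCapsG → NearConstantShortTimeHL :=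
  fun hSt2 hS2 hS3 hS4 =>
    stub_entropyToLLN (stub_meansToRelEntropy (meansConverge_of_nearConstantRelEntropy
      (stub_meansPin stub_ldaGeneralFamilies stub_concentrationGeneralFamilies
        (stub_reductionI stub_dynamicI hSt2 stub_uniformPressure stub_staticLLN stub_smallTiltDomination hS2 hS3 hS4))))

/-- **THE CRUX FROM THE THREE DYNAMICAL CONJECTURES ALONE.** With the statics side of the line `small-tilt-domination` closed
(`mesoscaleDensityLD_holds`, the landed position / velocity split and the net reduction), the hydrodynamic-limit crux `NearConstantShortTimeHL`
follows from the equilibrium momentum / energy closure tightness under the integrated fourth-moment cap (S2‴, S3‴) and the a-priori caps with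
Gaussian velocity tails along the true law (S4′) — no quartic a-priori input. [cite: Yau1991, §2] -/
theorem nearConstantShortTimeHL_of_dynamics3 :
    MomentumClosureTightnessI → EnergyClosureTightnessI → TrueLawCapsG → NearConstantShortTimeHL :=
  nearConstantShortTimeHL_of_inputsI
    (mesoscaleSuperlinearityE_of (positionMesoscaleLD_of_densityLD mesoscaleDensityLD_holds) (stub_velocityLD stub_ballGaussianEstimate))

end Summit.AtomisticToContinuum.HydrodynamicLimit.Theorems.NearConstantShortTimeHL

end
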